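import Literature.AlgebraicGeometry.Hyperkaehler.HomologicalNumericalEquivalenceHyperkaehler
import Literature.AlgebraicGeometry.HodgeTheory.AlgebraicClassesPullbackHolds
import HarnessLib

/-!
# Consequences of the discharged cup-product closure (Voisin 2002 §11.1.2) for hyperkähler varieties of K3^[n] and Kummer type (Charles–Markman 2013, Foster 2024)

Family `hodge`, layer `Literature/AlgebraicGeometry/Hyperkaehler`. THEOREMS ONLY: the hypothesis-free forms
(`foo'` := `foo Voisin2003_cupProduct_algebraicClasses_holds' …`) of the theorems of
`Hyperkaehler/HomologicalNumericalEquivalenceHyperkaehler` that took the named fact `Voisin2003_cupProduct_algebraicClasses`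
as a displayed hypothesis; that fact is PROVED in the tree (`AlgebraicClassesPullbackHolds`,
`Voisin2003_cupProduct_algebraicClasses_holds'`). Lane `lit-hodgefound`, seat p20.

## References

* [VoisinHodgeI2002] C. Voisin, Hodge Theory and Complex Algebraic Geometry I, §11.1.2.
* [Fulton1998] W. Fulton, Intersection Theory, §19.2 Cor. 19.2 (b).
-/

noncomputable section

open CategoryTheory AlgebraicGeometry MonoidalCategory
open Literature.AlgebraicTopology.SingularHomology
open Literature.AlgebraicGeometry.HodgeTheory
open Literature.AlgebraicGeometry.Motives (IsSmoothProjective)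

namespace Literature.AlgebraicGeometry.Hyperkaehler.CharlesMarkman2013_lefschetzStandard_K3HilbertType

/-! ### From `HomologicalNumericalEquivalenceHyperkaehler` -/

/-- (Hypothesis-free form of `eq_zero_of_mem_algebraicClasses_of_forall_pairing_eq_zero_of_cupProduct_algebraicClasses`: `Voisin2003_cupProduct_algebraicClasses` is now a Literature
theorem, `Voisin2003_cupProduct_algebraicClasses_holds'`.) `D(X)` with `ℚ`-coefficients for `K3^[n]`-type with Prop. 9.20 in the packaged form of the named
fact `HodgeTheory.Voisin2003_cupProduct_algebraicClasses`. [cite: CharlesMarkman2013, Cor. 1.2 (§1)]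
[cite: VoisinHodgeII2003, §9.2.4 Prop. 9.20] -/
theorem eq_zero_of_mem_algebraicClasses_of_forall_pairing_eq_zero_of_cupProduct_algebraicClasses'
    {n : ℕ} {X : Motives.SchemeOver ℂ} (h : CharlesMarkman2013_lefschetzStandard_K3HilbertType)
    (hX : IsSmoothProjective (2 * n) X) (hK : IsOfK3HilbertType n X) {p q : ℕ}
    (hpq : 2 * p + 2 * q = 2 * (2 * n))
    (μ : HomologicalOrientation ℤ (Motives.ComplexPoints X) (2 * (2 * n)))
    {x : singularCohomology ℚ ℚ (Motives.ComplexPoints X) (2 * p)}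
    (hx : ofRatClass (Motives.ComplexPoints X) (2 * p) x ∈ algebraicClasses X p)
    (hnum : ∀ z : singularCohomology ℚ ℚ (Motives.ComplexPoints X) (2 * q), ofRatClass (Motives.ComplexPoints X) (2 * q) z ∈ algebraicClasses X q → kroneckerPairing ℚ ℚ (Motives.ComplexPoints X) (2 * (2 * n)) (cupProduct hpq x z) (singularHomology.coeffChange (Motives.ComplexPoints X) (algebraMap ℤ ℚ : ℤ →+* ℚ).toAddMonoidHom (2 * (2 * n)) μ.fundamentalClass) = 0) :
    x = 0 :=
  eq_zero_of_mem_algebraicClasses_of_forall_pairing_eq_zero_of_cupProduct_algebraicClasses h Voisin2003_cupProduct_algebraicClasses_holds' hX hK hpq μ hx hnum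

end Literature.AlgebraicGeometry.Hyperkaehler.CharlesMarkman2013_lefschetzStandard_K3HilbertType

namespace Literature.AlgebraicGeometry.Hyperkaehler.Foster2024_lefschetzStandard_kummerType_prime

/-! ### From `HomologicalNumericalEquivalenceHyperkaehler` -/

/-- (Hypothesis-free form of `eq_zero_of_mem_algebraicClasses_of_forall_pairing_eq_zero_of_cupProduct_algebraicClasses`: `Voisin2003_cupProduct_algebraicClasses` is now a Literature
theorem, `Voisin2003_cupProduct_algebraicClasses_holds'`.) `D(X)` with `ℚ`-coefficients for `Kumⁿ`-type, `n + 1` prime, with Prop. 9.20 in the packaged form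
of the named fact `HodgeTheory.Voisin2003_cupProduct_algebraicClasses`. [cite: Foster2024, Cor. 2 (§1.1)]
[cite: VoisinHodgeII2003, §9.2.4 Prop. 9.20] -/
theorem eq_zero_of_mem_algebraicClasses_of_forall_pairing_eq_zero_of_cupProduct_algebraicClasses'
    {n : ℕ} {X : Motives.SchemeOver ℂ} (h : Foster2024_lefschetzStandard_kummerType_prime)
    (hn : (n + 1).Prime) (hX : IsSmoothProjective (2 * n) X) (hK : IsOfGeneralizedKummerType n X)
    {p q : ℕ} (hpq : 2 * p + 2 * q = 2 * (2 * n))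
    (μ : HomologicalOrientation ℤ (Motives.ComplexPoints X) (2 * (2 * n)))
    {x : singularCohomology ℚ ℚ (Motives.ComplexPoints X) (2 * p)}
    (hx : ofRatClass (Motives.ComplexPoints X) (2 * p) x ∈ algebraicClasses X p)
    (hnum : ∀ z : singularCohomology ℚ ℚ (Motives.ComplexPoints X) (2 * q), ofRatClass (Motives.ComplexPoints X) (2 * q) z ∈ algebraicClasses X q → kroneckerPairing ℚ ℚ (Motives.ComplexPoints X) (2 * (2 * n)) (cupProduct hpq x z) (singularHomology.coeffChange (Motives.ComplexPoints X) (algebraMap ℤ ℚ : ℤ →+* ℚ).toAddMonoidHom (2 * (2 * n)) μ.fundamentalClass) = 0) :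
    x = 0 :=
  eq_zero_of_mem_algebraicClasses_of_forall_pairing_eq_zero_of_cupProduct_algebraicClasses h Voisin2003_cupProduct_algebraicClasses_holds' hn hX hK hpq μ hx hnum

end Literature.AlgebraicGeometry.Hyperkaehler.Foster2024_lefschetzStandard_kummerType_prime

end
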